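import Mathlib
import Summits.NavierStokesRegularity.NavierStokesRegularity.Theorems.DssFarFieldSlavingBlowupTypeIDssProfileSimilarityEnstrophyHardyCore
import HarnessLib

/-!
# Route StretchingWellBinding — support item `DssProfileBinding` (stmt-NavierStokesRegularity-1578),
  helper file 1/4: enstrophy bookkeeping for ONE decaying slice

For a smooth, bounded, divergence-free slice `w : EuclideanSpace ℝ (Fin 3) → EuclideanSpace ℝ (Fin 3)` with the decay
`‖Dw(x)‖ ≤ K₁(1+‖x‖)^{−2}`, `‖D²w(x)‖ ≤ K₂(1+‖x‖)^{−3}`, `‖D³w(x)‖ ≤ K₃(1+‖x‖)^{−4}` (what the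
scale-invariant decay `(‖x‖ + √(−t))^{k+1}‖Dᵏu(t)(x)‖ ≤ C_k` of `Theses.StretchingWellBinding.DssProfileBinding`
gives on every time slice), the vorticity `ω = curl w` obeys `‖ω‖ ≲ (1+‖x‖)^{−2}`, `‖Dω‖ ≲ (1+‖x‖)^{−3}`,
`‖Δω‖ ≲ (1+‖x‖)^{−4}`, the right-hand side `νΔω − Dω(w) + Dw(ω)` of the vorticity equation is
`≲ (1+‖x‖)^{−2}`, the five enstrophy-budget pairings are integrable, and
`∫ 2⟪ω, νΔω − Dω(w) + Dw(ω)⟫ = 2(∫⟪ω, Dw ω⟫ − ν∫|∇ω|²_F)` (whole-space Green identity and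
incompressible transport under integrability only — the cell pub-ns-dss tools
`SimilarityEnstrophy.integral_inner_laplacian_self_eq_neg_integral_frobeniusNormSq`,
`SimilarityEnstrophy.integral_inner_convect_self_eq_zero`). Physical-variables twin of the slice
bookkeeping of the tree's `…SimilarityEnstrophyDecay` / `…Integrability` files (Majda–Bertozzi §1.2,
§2.4 folklore).

HONEST FRAMING: bookkeeping about a HYPOTHETICAL decaying field; nothing here bears on Navier–Stokes
regularity. Lands `--supports stmt-NavierStokesRegularity-1578` (other route; label-free; typer seat g19
of cell pub-ns-dss, idle-row item).
-/

noncomputable section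

set_option linter.dupNamespace false

namespace Summit.NavierStokesRegularity.NavierStokesRegularity.Theorems.DssBinding

open MeasureTheory Set Filter Topology Module Metric InnerProductSpace Function
open scoped RealInnerProductSpace Laplacian ContDiff
open Literature.Analysis Literature.Analysis.FluidPDE
open Summit.NavierStokesRegularity.NavierStokesRegularity.Theorems.SimilarityEnstrophy
open Summit.NavierStokesRegularity.NavierStokesRegularity.Theorems.PlanarEnergyAPriori

/-! ### Pointwise bounds for the vorticity of a decaying slice -/

section Slice

variable {w : EuclideanSpace ℝ (Fin 3) → EuclideanSpace ℝ (Fin 3)} {K₀ K₁ K₂ K₃ : ℝ}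

/-- The curl of a `C^∞` field is `C^∞`. [folklore] -/
theorem contDiff_curl_smooth (hw : ContDiff ℝ ∞ w) : ContDiff ℝ ∞ (curl w) :=
  contDiff_curl (n := ⊤) (hw.of_le (by exact_mod_cast le_top))

/-- `‖curl w(x)‖ ≤ ‖curl‖ K₁ (1 + ‖x‖)^{−2}` from `‖Dw(x)‖ ≤ K₁ (1 + ‖x‖)^{−2}`. [folklore] -/
theorem norm_curl_le_decay (h1 : ∀ x, ‖fderiv ℝ w x‖ ≤ K₁ * (1 + ‖x‖) ^ (-(2 : ℝ))) (x : EuclideanSpace ℝ (Fin 3)) :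
    ‖curl w x‖ ≤ ‖curlCLM‖ * K₁ * (1 + ‖x‖) ^ (-(2 : ℝ)) := by
  rw [mul_assoc]
  exact (norm_curl_le w x).trans (mul_le_mul_of_nonneg_left (h1 x) (norm_nonneg curlCLM))

/-- `‖D(curl w)(x)‖ ≤ ‖curl‖ K₂ (1 + ‖x‖)^{−3}` from `‖D²w(x)‖ ≤ K₂ (1 + ‖x‖)^{−3}`. [folklore] -/
theorem norm_fderiv_curl_le_decay (hw : ContDiff ℝ ∞ w)
    (h2 : ∀ x, ‖iteratedFDeriv ℝ 2 w x‖ ≤ K₂ * (1 + ‖x‖) ^ (-(3 : ℝ))) (x : EuclideanSpace ℝ (Fin 3)) :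
    ‖fderiv ℝ (curl w) x‖ ≤ ‖curlCLM‖ * K₂ * (1 + ‖x‖) ^ (-(3 : ℝ)) := by
  have hw3 : ContDiff ℝ 3 w := hw.of_le (by norm_cast)
  have hd : DifferentiableAt ℝ (fderiv ℝ w) x :=
    ((hw3.fderiv_right (m := 2) (by norm_cast)).differentiable (by norm_num)) x
  have hD : fderiv ℝ (curl w) x = curlCLM.comp (fderiv ℝ (fderiv ℝ w) x) := by
    rw [curl_eq_curlCLM_comp]
    exact (curlCLM.hasFDerivAt.comp x hd.hasFDerivAt).fderiv
  rw [hD, mul_assoc]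
  refine (ContinuousLinearMap.opNorm_comp_le _ _).trans (mul_le_mul_of_nonneg_left ?_ (norm_nonneg _))
  rw [← norm_iteratedFDeriv_one, norm_iteratedFDeriv_fderiv]
  exact h2 x

/-- `‖D²(curl w)(x)‖ ≤ ‖curl‖ K₃ (1 + ‖x‖)^{−4}` from `‖D³w(x)‖ ≤ K₃ (1 + ‖x‖)^{−4}`. [folklore] -/
theorem norm_fderiv_fderiv_curl_le_decay (hw : ContDiff ℝ ∞ w)
    (h3 : ∀ x, ‖iteratedFDeriv ℝ 3 w x‖ ≤ K₃ * (1 + ‖x‖) ^ (-(4 : ℝ))) (x : EuclideanSpace ℝ (Fin 3)) :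
    ‖fderiv ℝ (fderiv ℝ (curl w)) x‖ ≤ ‖curlCLM‖ * K₃ * (1 + ‖x‖) ^ (-(4 : ℝ)) := by
  have hw4 : ContDiff ℝ 4 w := hw.of_le (by norm_cast)
  have hf3 : ContDiff ℝ 3 (fderiv ℝ w) := hw4.fderiv_right (m := 3) (by norm_cast)
  rw [← norm_iteratedFDeriv_one, norm_iteratedFDeriv_fderiv, curl_eq_curlCLM_comp,
    curlCLM.iteratedFDeriv_comp_left (hf3.contDiffAt) (by norm_cast), mul_assoc]
  refine (ContinuousLinearMap.norm_compContinuousMultilinearMap_le _ _).trans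
    (mul_le_mul_of_nonneg_left ?_ (norm_nonneg _))
  rw [norm_iteratedFDeriv_fderiv]
  exact h3 x

/-- `‖Δ(curl w)(x)‖ ≤ 3 ‖curl‖ K₃ (1 + ‖x‖)^{−4}`. [folklore] -/
theorem norm_laplacian_curl_le_decay (hw : ContDiff ℝ ∞ w)
    (h3 : ∀ x, ‖iteratedFDeriv ℝ 3 w x‖ ≤ K₃ * (1 + ‖x‖) ^ (-(4 : ℝ))) (x : EuclideanSpace ℝ (Fin 3)) :
    ‖(Δ (curl w)) x‖ ≤ 3 * (‖curlCLM‖ * K₃) * (1 + ‖x‖) ^ (-(4 : ℝ)) := by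
  have h := FluidPDE.norm_laplacian_le (curl w) x
  rw [finrank_euclideanSpace_fin] at h
  calc ‖(Δ (curl w)) x‖ ≤ 3 * ‖fderiv ℝ (fderiv ℝ (curl w)) x‖ := by exact_mod_cast h
    _ ≤ 3 * (‖curlCLM‖ * K₃ * (1 + ‖x‖) ^ (-(4 : ℝ))) := by
        gcongr; exact norm_fderiv_fderiv_curl_le_decay hw h3 x
    _ = 3 * (‖curlCLM‖ * K₃) * (1 + ‖x‖) ^ (-(4 : ℝ)) := by ring

/-- **The right-hand side of the vorticity equation decays like `(1 + ‖x‖)^{−2}`:**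
`‖νΔω − Dω(w) + Dw(ω)‖ ≤ K (1 + ‖x‖)^{−2}` for a bounded slice `w` (`‖w‖ ≤ K₀`) with
`‖Dw‖ ≲ (1+‖x‖)^{−2}`, `‖D²w‖ ≲ (1+‖x‖)^{−3}`, `‖D³w‖ ≲ (1+‖x‖)^{−4}`, `ω = curl w`. [folklore] -/
theorem norm_vorticityRHS_le_decay (hw : ContDiff ℝ ∞ w) (ν : ℝ) (h0 : ∀ x, ‖w x‖ ≤ K₀)
    (h1 : ∀ x, ‖fderiv ℝ w x‖ ≤ K₁ * (1 + ‖x‖) ^ (-(2 : ℝ)))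
    (h2 : ∀ x, ‖iteratedFDeriv ℝ 2 w x‖ ≤ K₂ * (1 + ‖x‖) ^ (-(3 : ℝ)))
    (h3 : ∀ x, ‖iteratedFDeriv ℝ 3 w x‖ ≤ K₃ * (1 + ‖x‖) ^ (-(4 : ℝ))) (x : EuclideanSpace ℝ (Fin 3)) :
    ‖ν • (Δ (curl w)) x - fderiv ℝ (curl w) x (w x) + fderiv ℝ w x (curl w x)‖ ≤
      (|ν| * (3 * (‖curlCLM‖ * K₃)) + ‖curlCLM‖ * K₂ * K₀ + K₁ * (‖curlCLM‖ * K₁)) *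
        (1 + ‖x‖) ^ (-(2 : ℝ)) := by
  have hK₀ : 0 ≤ K₀ := (norm_nonneg _).trans (h0 0)
  have hK₁ : 0 ≤ K₁ := SlabLaw.nonneg_of_norm_le_rpow h1
  have hK₂ : 0 ≤ K₂ := SlabLaw.nonneg_of_norm_le_rpow h2
  have hK₃ : 0 ≤ K₃ := SlabLaw.nonneg_of_norm_le_rpow h3
  have hc : 0 ≤ ‖curlCLM‖ := norm_nonneg curlCLM
  have t1 : ‖ν • (Δ (curl w)) x‖ ≤ |ν| * (3 * (‖curlCLM‖ * K₃)) * (1 + ‖x‖) ^ (-(2 : ℝ)) := by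
    rw [norm_smul, Real.norm_eq_abs, mul_assoc]
    refine mul_le_mul_of_nonneg_left ?_ (abs_nonneg ν)
    exact (norm_laplacian_curl_le_decay hw h3 x).trans
      (mul_le_mul_of_nonneg_left (SlabLaw.rpow_neg_le_rpow_neg_of_le x (by norm_num)) (by positivity))
  have t2 : ‖fderiv ℝ (curl w) x (w x)‖ ≤ ‖curlCLM‖ * K₂ * K₀ * (1 + ‖x‖) ^ (-(2 : ℝ)) := by
    have h10 : 0 ≤ ‖curlCLM‖ * K₂ * (1 + ‖x‖) ^ (-(3 : ℝ)) := by positivity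
    calc ‖fderiv ℝ (curl w) x (w x)‖ ≤ ‖fderiv ℝ (curl w) x‖ * ‖w x‖ :=
          ContinuousLinearMap.le_opNorm _ _
      _ ≤ ‖curlCLM‖ * K₂ * (1 + ‖x‖) ^ (-(3 : ℝ)) * K₀ :=
          mul_le_mul (norm_fderiv_curl_le_decay hw h2 x) (h0 x) (norm_nonneg _) h10
      _ = ‖curlCLM‖ * K₂ * K₀ * (1 + ‖x‖) ^ (-(3 : ℝ)) := by ring
      _ ≤ ‖curlCLM‖ * K₂ * K₀ * (1 + ‖x‖) ^ (-(2 : ℝ)) :=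
          mul_le_mul_of_nonneg_left (SlabLaw.rpow_neg_le_rpow_neg_of_le x (by norm_num)) (by positivity)
  have t3 : ‖fderiv ℝ w x (curl w x)‖ ≤ K₁ * (‖curlCLM‖ * K₁) * (1 + ‖x‖) ^ (-(2 : ℝ)) := by
    have h10 : 0 ≤ K₁ * (1 + ‖x‖) ^ (-(2 : ℝ)) := by positivity
    calc ‖fderiv ℝ w x (curl w x)‖ ≤ ‖fderiv ℝ w x‖ * ‖curl w x‖ :=
          ContinuousLinearMap.le_opNorm _ _
      _ ≤ (K₁ * (1 + ‖x‖) ^ (-(2 : ℝ))) * (‖curlCLM‖ * K₁ * (1 + ‖x‖) ^ (-(2 : ℝ))) :=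
          mul_le_mul (h1 x) (norm_curl_le_decay h1 x) (norm_nonneg _) h10
      _ = K₁ * (‖curlCLM‖ * K₁) * (1 + ‖x‖) ^ (-((2 : ℝ) + 2)) := by
          rw [← SlabLaw.rpow_neg_mul_rpow_neg]; ring
      _ ≤ K₁ * (‖curlCLM‖ * K₁) * (1 + ‖x‖) ^ (-(2 : ℝ)) :=
          mul_le_mul_of_nonneg_left (SlabLaw.rpow_neg_le_rpow_neg_of_le x (by norm_num)) (by positivity)
  have hA : ‖ν • (Δ (curl w)) x - fderiv ℝ (curl w) x (w x) + fderiv ℝ w x (curl w x)‖ ≤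
      ‖ν • (Δ (curl w)) x‖ + ‖fderiv ℝ (curl w) x (w x)‖ + ‖fderiv ℝ w x (curl w x)‖ := by
    have e1 := norm_add_le (ν • (Δ (curl w)) x - fderiv ℝ (curl w) x (w x)) (fderiv ℝ w x (curl w x))
    have e2 := norm_sub_le (ν • (Δ (curl w)) x) (fderiv ℝ (curl w) x (w x))
    linarith
  have hB : ‖ν • (Δ (curl w)) x‖ + ‖fderiv ℝ (curl w) x (w x)‖ + ‖fderiv ℝ w x (curl w x)‖ ≤
      |ν| * (3 * (‖curlCLM‖ * K₃)) * (1 + ‖x‖) ^ (-(2 : ℝ))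
          + ‖curlCLM‖ * K₂ * K₀ * (1 + ‖x‖) ^ (-(2 : ℝ))
          + K₁ * (‖curlCLM‖ * K₁) * (1 + ‖x‖) ^ (-(2 : ℝ)) := add_le_add (add_le_add t1 t2) t3
  have hC : |ν| * (3 * (‖curlCLM‖ * K₃)) * (1 + ‖x‖) ^ (-(2 : ℝ))
          + ‖curlCLM‖ * K₂ * K₀ * (1 + ‖x‖) ^ (-(2 : ℝ))
          + K₁ * (‖curlCLM‖ * K₁) * (1 + ‖x‖) ^ (-(2 : ℝ)) =
      (|ν| * (3 * (‖curlCLM‖ * K₃)) + ‖curlCLM‖ * K₂ * K₀ + K₁ * (‖curlCLM‖ * K₁)) *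
        (1 + ‖x‖) ^ (-(2 : ℝ)) := by ring
  exact hA.trans (hB.trans hC.le)

/-! ### Integrability of the enstrophy budget terms of a decaying slice -/

/-- `‖curl w‖² ∈ L¹(EuclideanSpace ℝ (Fin 3))` (`‖curl w‖ ≲ (1 + ‖x‖)^{−2}`). [folklore] -/
theorem integrable_norm_curl_sq (hw : ContDiff ℝ ∞ w)
    (h1 : ∀ x, ‖fderiv ℝ w x‖ ≤ K₁ * (1 + ‖x‖) ^ (-(2 : ℝ))) :
    Integrable fun x => ‖curl w x‖ ^ 2 := by
  have hc := (contDiff_curl_smooth hw).continuous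
  refine integrable_of_le_decay_four (hc.norm.pow 2) (K := (‖curlCLM‖ * K₁) ^ 2) fun x => ?_
  rw [norm_pow, norm_norm]
  have h := norm_curl_le_decay h1 x
  calc ‖curl w x‖ ^ 2 ≤ (‖curlCLM‖ * K₁ * (1 + ‖x‖) ^ (-(2 : ℝ))) ^ 2 :=
        pow_le_pow_left₀ (norm_nonneg _) h 2
    _ = (‖curlCLM‖ * K₁) ^ 2 * ((1 + ‖x‖) ^ (-(2 : ℝ)) * (1 + ‖x‖) ^ (-(2 : ℝ))) := by ring
    _ = (‖curlCLM‖ * K₁) ^ 2 * (1 + ‖x‖) ^ (-(4 : ℝ)) := by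
        rw [SlabLaw.rpow_neg_mul_rpow_neg]; norm_num

/-- `|∇ curl w|²_F ∈ L¹(EuclideanSpace ℝ (Fin 3))` (`‖D curl w‖ ≲ (1 + ‖x‖)^{−3}`, `|·|²_F ≤ 3‖·‖²`). [folklore] -/
theorem integrable_frobeniusNormSq_fderiv_curl (hw : ContDiff ℝ ∞ w)
    (h2 : ∀ x, ‖iteratedFDeriv ℝ 2 w x‖ ≤ K₂ * (1 + ‖x‖) ^ (-(3 : ℝ))) :
    Integrable fun x => frobeniusNormSq (fderiv ℝ (curl w) x) := by
  have hω : ContDiff ℝ ∞ (curl w) := contDiff_curl_smooth hw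
  have hc : Continuous fun x => frobeniusNormSq (fderiv ℝ (curl w) x) := by
    unfold frobeniusNormSq
    exact continuous_finsetSum _ fun i _ =>
      (((hω.continuous_fderiv (by simp)).clm_apply continuous_const).norm).pow 2
  refine integrable_of_le_decay_four hc (K := 3 * (‖curlCLM‖ * K₂) ^ 2) fun x => ?_
  rw [Real.norm_of_nonneg (frobeniusNormSq_nonneg _)]
  have h := norm_fderiv_curl_le_decay hw h2 x
  have hK : 0 ≤ 3 * (‖curlCLM‖ * K₂) ^ 2 := by positivity
  calc frobeniusNormSq (fderiv ℝ (curl w) x) ≤ 3 * ‖fderiv ℝ (curl w) x‖ ^ 2 :=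
        frobeniusNormSq_le_three_mul _
    _ ≤ 3 * (‖curlCLM‖ * K₂ * (1 + ‖x‖) ^ (-(3 : ℝ))) ^ 2 :=
        mul_le_mul_of_nonneg_left (pow_le_pow_left₀ (norm_nonneg _) h 2) (by norm_num)
    _ = 3 * (‖curlCLM‖ * K₂) ^ 2 * ((1 + ‖x‖) ^ (-(3 : ℝ)) * (1 + ‖x‖) ^ (-(3 : ℝ))) := by ring
    _ = 3 * (‖curlCLM‖ * K₂) ^ 2 * (1 + ‖x‖) ^ (-(6 : ℝ)) := by
        rw [SlabLaw.rpow_neg_mul_rpow_neg]; norm_num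
    _ ≤ 3 * (‖curlCLM‖ * K₂) ^ 2 * (1 + ‖x‖) ^ (-(4 : ℝ)) :=
        mul_le_mul_of_nonneg_left (SlabLaw.rpow_neg_le_rpow_neg_of_le x (by norm_num)) hK

set_option maxHeartbeats 400000 in
/-- `⟪Δ curl w, curl w⟫ ∈ L¹(EuclideanSpace ℝ (Fin 3))`. [folklore] -/
theorem integrable_inner_laplacian_curl (hw : ContDiff ℝ ∞ w)
    (h1 : ∀ x, ‖fderiv ℝ w x‖ ≤ K₁ * (1 + ‖x‖) ^ (-(2 : ℝ)))
    (h3 : ∀ x, ‖iteratedFDeriv ℝ 3 w x‖ ≤ K₃ * (1 + ‖x‖) ^ (-(4 : ℝ))) :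
    Integrable fun x => ⟪(Δ (curl w)) x, curl w x⟫ := by
  have hω : ContDiff ℝ ∞ (curl w) := contDiff_curl_smooth hw
  refine integrable_of_le_decay_four
    ((continuous_laplacian (hω.of_le (by norm_cast))).inner hω.continuous)
    (K := 3 * (‖curlCLM‖ * K₃) * (‖curlCLM‖ * K₁)) fun x => ?_
  have e1 := norm_laplacian_curl_le_decay hw h3 x
  have e2 := norm_curl_le_decay h1 x
  have e10 : 0 ≤ 3 * (‖curlCLM‖ * K₃) * (1 + ‖x‖) ^ (-(4 : ℝ)) := (norm_nonneg _).trans e1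
  have hK : 0 ≤ 3 * (‖curlCLM‖ * K₃) * (‖curlCLM‖ * K₁) := by
    have := SlabLaw.nonneg_of_norm_le_rpow h1; have := SlabLaw.nonneg_of_norm_le_rpow h3; positivity
  calc ‖⟪(Δ (curl w)) x, curl w x⟫‖ ≤ ‖(Δ (curl w)) x‖ * ‖curl w x‖ := norm_inner_le_norm _ _
    _ ≤ (3 * (‖curlCLM‖ * K₃) * (1 + ‖x‖) ^ (-(4 : ℝ))) * (‖curlCLM‖ * K₁ * (1 + ‖x‖) ^ (-(2 : ℝ))) :=
        mul_le_mul e1 e2 (norm_nonneg _) e10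
    _ = 3 * (‖curlCLM‖ * K₃) * (‖curlCLM‖ * K₁) * (1 + ‖x‖) ^ (-((4 : ℝ) + 2)) := by
        rw [← SlabLaw.rpow_neg_mul_rpow_neg]; ring
    _ ≤ 3 * (‖curlCLM‖ * K₃) * (‖curlCLM‖ * K₁) * (1 + ‖x‖) ^ (-(4 : ℝ)) :=
        mul_le_mul_of_nonneg_left (SlabLaw.rpow_neg_le_rpow_neg_of_le x (by norm_num)) hK

/-- `⟪(w·∇) curl w, curl w⟫ ∈ L¹(EuclideanSpace ℝ (Fin 3))` (transport pairing; `w` bounded). [folklore] -/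
theorem integrable_inner_convect_curl (hw : ContDiff ℝ ∞ w) (h0 : ∀ x, ‖w x‖ ≤ K₀)
    (h1 : ∀ x, ‖fderiv ℝ w x‖ ≤ K₁ * (1 + ‖x‖) ^ (-(2 : ℝ)))
    (h2 : ∀ x, ‖iteratedFDeriv ℝ 2 w x‖ ≤ K₂ * (1 + ‖x‖) ^ (-(3 : ℝ))) :
    Integrable fun x => ⟪convect w (curl w) x, curl w x⟫ := by
  have hω : ContDiff ℝ ∞ (curl w) := contDiff_curl_smooth hw
  have hc : Continuous fun x => ⟪convect w (curl w) x, curl w x⟫ := by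
    simp only [convect]
    exact ((hω.continuous_fderiv (by simp)).clm_apply hw.continuous).inner hω.continuous
  refine integrable_of_le_decay_four hc (K := (‖curlCLM‖ * K₂) * K₀ * (‖curlCLM‖ * K₁)) fun x => ?_
  have e1 := norm_fderiv_curl_le_decay hw h2 x
  have e2 := norm_curl_le_decay h1 x
  have hK₀ : 0 ≤ K₀ := (norm_nonneg _).trans (h0 0)
  have e10 : 0 ≤ ‖curlCLM‖ * K₂ * (1 + ‖x‖) ^ (-(3 : ℝ)) := (norm_nonneg _).trans e1
  have hK : 0 ≤ (‖curlCLM‖ * K₂) * K₀ * (‖curlCLM‖ * K₁) := by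
    have := SlabLaw.nonneg_of_norm_le_rpow h1; have := SlabLaw.nonneg_of_norm_le_rpow h2; positivity
  simp only [convect]
  calc ‖⟪fderiv ℝ (curl w) x (w x), curl w x⟫‖
      ≤ ‖fderiv ℝ (curl w) x (w x)‖ * ‖curl w x‖ := norm_inner_le_norm _ _
    _ ≤ (‖fderiv ℝ (curl w) x‖ * ‖w x‖) * ‖curl w x‖ :=
        mul_le_mul_of_nonneg_right (ContinuousLinearMap.le_opNorm _ _) (norm_nonneg _)
    _ ≤ (‖curlCLM‖ * K₂ * (1 + ‖x‖) ^ (-(3 : ℝ)) * K₀) * (‖curlCLM‖ * K₁ * (1 + ‖x‖) ^ (-(2 : ℝ))) :=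
        mul_le_mul (mul_le_mul e1 (h0 x) (norm_nonneg _) e10) e2 (norm_nonneg _) (mul_nonneg e10 hK₀)
    _ = (‖curlCLM‖ * K₂) * K₀ * (‖curlCLM‖ * K₁) * (1 + ‖x‖) ^ (-((3 : ℝ) + 2)) := by
        rw [← SlabLaw.rpow_neg_mul_rpow_neg]; ring
    _ ≤ (‖curlCLM‖ * K₂) * K₀ * (‖curlCLM‖ * K₁) * (1 + ‖x‖) ^ (-(4 : ℝ)) :=
        mul_le_mul_of_nonneg_left (SlabLaw.rpow_neg_le_rpow_neg_of_le x (by norm_num)) hK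

/-- The stretching pairing `⟪curl w, Dw (curl w)⟫ ∈ L¹(EuclideanSpace ℝ (Fin 3))`. [folklore] -/
theorem integrable_inner_stretching_curl (hw : ContDiff ℝ ∞ w)
    (h1 : ∀ x, ‖fderiv ℝ w x‖ ≤ K₁ * (1 + ‖x‖) ^ (-(2 : ℝ))) :
    Integrable fun x => ⟪curl w x, fderiv ℝ w x (curl w x)⟫ := by
  have hω : ContDiff ℝ ∞ (curl w) := contDiff_curl_smooth hw
  refine integrable_of_le_decay_four
    (hω.continuous.inner ((hw.continuous_fderiv (by simp)).clm_apply hω.continuous))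
    (K := (‖curlCLM‖ * K₁) * (K₁ * (‖curlCLM‖ * K₁))) fun x => ?_
  have e1 := h1 x
  have e2 := norm_curl_le_decay h1 x
  have hK₁ : 0 ≤ K₁ := SlabLaw.nonneg_of_norm_le_rpow h1
  have e10 : 0 ≤ K₁ * (1 + ‖x‖) ^ (-(2 : ℝ)) := by positivity
  have e20 : 0 ≤ ‖curlCLM‖ * K₁ * (1 + ‖x‖) ^ (-(2 : ℝ)) := by positivity
  have hK : 0 ≤ (‖curlCLM‖ * K₁) * (K₁ * (‖curlCLM‖ * K₁)) := by positivity
  calc ‖⟪curl w x, fderiv ℝ w x (curl w x)⟫‖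
      ≤ ‖curl w x‖ * ‖fderiv ℝ w x (curl w x)‖ := norm_inner_le_norm _ _
    _ ≤ ‖curl w x‖ * (‖fderiv ℝ w x‖ * ‖curl w x‖) :=
        mul_le_mul_of_nonneg_left (ContinuousLinearMap.le_opNorm _ _) (norm_nonneg _)
    _ ≤ (‖curlCLM‖ * K₁ * (1 + ‖x‖) ^ (-(2 : ℝ))) *
          ((K₁ * (1 + ‖x‖) ^ (-(2 : ℝ))) * (‖curlCLM‖ * K₁ * (1 + ‖x‖) ^ (-(2 : ℝ)))) :=
        mul_le_mul e2 (mul_le_mul e1 e2 (norm_nonneg _) e10) (by positivity) e20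
    _ = (‖curlCLM‖ * K₁) * (K₁ * (‖curlCLM‖ * K₁)) * (1 + ‖x‖) ^ (-(((2 : ℝ) + 2) + 2)) := by
        rw [← SlabLaw.rpow_neg_mul_rpow_neg, ← SlabLaw.rpow_neg_mul_rpow_neg]; ring
    _ ≤ (‖curlCLM‖ * K₁) * (K₁ * (‖curlCLM‖ * K₁)) * (1 + ‖x‖) ^ (-(4 : ℝ)) :=
        mul_le_mul_of_nonneg_left (SlabLaw.rpow_neg_le_rpow_neg_of_le x (by norm_num)) hK

/-- **The slice identity.** For a smooth, bounded, divergence-free slice `w` with the three decay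
bounds: `∫ 2⟪ω, νΔω − Dω(w) + Dw(ω)⟫ = 2(∫⟪ω, Dw ω⟫ − ν∫|∇ω|²_F)`, `ω = curl w` (Green's identity
and incompressible transport on the whole space, under integrability only). [folklore] -/
theorem integral_enstrophyPairing_eq (hw : ContDiff ℝ ∞ w) (hdiv : VectorCalculus.IsDivFree w)
    (ν : ℝ) (h0 : ∀ x, ‖w x‖ ≤ K₀)
    (h1 : ∀ x, ‖fderiv ℝ w x‖ ≤ K₁ * (1 + ‖x‖) ^ (-(2 : ℝ)))
    (h2 : ∀ x, ‖iteratedFDeriv ℝ 2 w x‖ ≤ K₂ * (1 + ‖x‖) ^ (-(3 : ℝ)))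
    (h3 : ∀ x, ‖iteratedFDeriv ℝ 3 w x‖ ≤ K₃ * (1 + ‖x‖) ^ (-(4 : ℝ))) :
    ∫ x, 2 * ⟪curl w x,
        ν • (Δ (curl w)) x - fderiv ℝ (curl w) x (w x) + fderiv ℝ w x (curl w x)⟫ =
      2 * ((∫ x, ⟪curl w x, fderiv ℝ w x (curl w x)⟫)
        - ν * ∫ x, frobeniusNormSq (fderiv ℝ (curl w) x)) := by
  have hω : ContDiff ℝ ∞ (curl w) := contDiff_curl_smooth hw
  have iZ := integrable_norm_curl_sq hw h1
  have iF := integrable_frobeniusNormSq_fderiv_curl hw h2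
  have iL := integrable_inner_laplacian_curl hw h1 h3
  have iT := integrable_inner_convect_curl hw h0 h1 h2
  have iS := integrable_inner_stretching_curl hw h1
  have hL := integral_inner_laplacian_self_eq_neg_integral_frobeniusNormSq hω iZ iF iL
  have hT := integral_inner_convect_self_eq_zero hω hw hdiv h0 iZ iT
  have hpt : ∀ x, 2 * ⟪curl w x,
      ν • (Δ (curl w)) x - fderiv ℝ (curl w) x (w x) + fderiv ℝ w x (curl w x)⟫ =
      2 * ν * ⟪(Δ (curl w)) x, curl w x⟫ - 2 * ⟪convect w (curl w) x, curl w x⟫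
        + 2 * ⟪curl w x, fderiv ℝ w x (curl w x)⟫ := by
    intro x
    have e1 : ⟪curl w x, (Δ (curl w)) x⟫ = ⟪(Δ (curl w)) x, curl w x⟫ := real_inner_comm _ _
    have e3 : ⟪curl w x, fderiv ℝ (curl w) x (w x)⟫ = ⟪convect w (curl w) x, curl w x⟫ := by
      simp only [convect]; exact real_inner_comm _ _
    simp only [inner_sub_right, inner_add_right, real_inner_smul_right, e1, e3]
    ring
  simp_rw [hpt]
  rw [integral_add ?_ (iS.const_mul 2), integral_sub (iL.const_mul (2 * ν)) (iT.const_mul 2),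
    integral_const_mul, integral_const_mul, integral_const_mul, hL, hT]
  · ring
  · exact (iL.const_mul (2 * ν)).sub (iT.const_mul 2)

end Slice

end Summit.NavierStokesRegularity.NavierStokesRegularity.Theorems.DssBinding

end
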